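import Mathlib
import HarnessLib
import Literature.Probability.LatticeModels.TorusFourierWienerBound
import Literature.Probability.LatticeModels.TorusFourierFirstMoment
import Summits.HubbardSuperconductivity.HubbardSuperconductivity.Theorems.KLProgrammeKLRegimeTwoVolumeDressedReadout

/-!
# Route `KLProgramme` — ENGINE child `KLRegimeEngineV16` (stmt-HubbardSuperconductivity-20236), `stub_twoLeg_scale0`, conjunct
# (E3f-AT)₀, spatial nested leg `hsp`: the EXPLICIT-SYMBOL numbers of the read-out — `ℓ¹` norm and first centred moment of the site
# kernel `torusFourierInv g` of lattice data from its sup and differences, uniformly in the volume (cell gate-hubbard-kl, seat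
# hubbard-kl-k3c5-p2 g6, β′ lane, item (r4-i) of the work order)

The door `…TwoVolumeReadoutPin.abs_klLocalPart_sub_le_gridDefect_pin` charges three explicit-symbol quantities: `‖τ̌_c‖₁ = Σ_z ‖torusFourierInv (τ∘p_{Lc}) z‖`,
`M₁(τ̌_f) = Σ_z tnorm(z)·‖torusFourierInv (τ∘p_{Lf}) z‖`, and the first centred moment `Σ_y (Σ_i |cRepZ (y i)|)·|c_{Re E∘p}(y)|` of the cosine
coefficients of the sampled explicit symbol (through `sum_far_abs_le_of_firstMoment`).  All three are controlled, UNIFORMLY IN THE VOLUME, by the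
sup and the lattice differences of orders `≤ 3` of the sampled data via the tree's Bernstein-type bounds
([tree] `TorusFourierWienerBound.sum_norm_torusFourier_le_of_differences`: `L⁻²Σ‖ĝ‖ ≤ 6√(S₀² + L²D₁²/8 + L⁴D₂²/256)`;
[tree] `TorusFourierFirstMoment.sum_abs_valMinAbs_mul_norm_torusFourier_le`: `L⁻²Σ|z̃_j|‖ĝ‖ ≤ 6√(L²D₁²/16 + L⁴D₂²/128 + L⁶D₃²/4096)` at `R = 1`):
for samples of a smooth `2π`-periodic symbol the differences are `D_j ≍ (2π/L)^j·‖D^j a‖_∞`, so every right-hand side is volume-free.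

* §1 `torusFourierInv g z = L⁻²·torusFourier g (−z)` (`torusFourierInv_eq_torusFourier_neg`), hence `Σ_z ‖torusFourierInv g z‖ = L⁻²Σ_z ‖torusFourier g z‖`
  and the same with the negation-invariant weights `|z̃_j|`;
* §2 **`sum_norm_torusFourierInv_le_of_differences`** (the `ℓ¹` norm), **`sum_tnorm_norm_torusFourierInv_le_of_differences`** (the tnorm-first
  moment, `tnorm ≤ |z̃₀| + |z̃₁|`), **`sum_absRep_abs_torusCosCoeff_le_of_differences`** (the cosine-coefficient first moment of even data `Re F`,
  `|c| ≤ ‖torusFourierInv F‖`).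

Proofs only; no definitions; nothing about the model.
-/

noncomputable section

namespace Summit.HubbardSuperconductivity.HubbardSuperconductivity.Theorems.TwoVolumeDefect

set_option linter.dupNamespace false -- summit = problem name (single-conjunct summit), D-0017

open Finset Complex Literature.MathematicalPhysics.QuantumLattice Literature.Probability.LatticeModels
open Summit.HubbardSuperconductivity.HubbardSuperconductivity.Theorems.KLRegimeSplit
open Summit.HubbardSuperconductivity.HubbardSuperconductivity.Theorems.TwoPointAssembly
open scoped ComplexConjugate

variable {L : ℕ} [NeZero L]

/-! ## §1 `torusFourierInv` versus `torusFourier` -/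

/-- `torusFourierInv g z = L^{-d}·torusFourier g (−z)`. -/
theorem torusFourierInv_eq_torusFourier_neg {d : ℕ} (g : TorusSite d L → ℂ) (z : TorusSite d L) :
    torusFourierInv g z = ((L : ℂ) ^ d)⁻¹ * torusFourier g (-z) := by
  rw [torusFourierInv_eq_sum_torusChar, torusFourier_eq_sum_torusChar]
  congr 1
  refine Finset.sum_congr rfl fun k _ => ?_
  rw [torusChar_comm (-z) k, torusChar_neg_right, Complex.conj_conj]

/-- `‖torusFourierInv g z‖ = L⁻²·‖torusFourier g (−z)‖` on `(ℤ/Lℤ)²`. -/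
theorem norm_torusFourierInv_eq (g : TorusSite 2 L → ℂ) (z : TorusSite 2 L) :
    ‖torusFourierInv g z‖ = ((L : ℝ) ^ 2)⁻¹ * ‖torusFourier g (-z)‖ := by
  rw [torusFourierInv_eq_torusFourier_neg, norm_mul, norm_inv, norm_pow, Complex.norm_natCast]

/-- A negation-invariant weighted sum of `‖torusFourierInv g‖` is `L⁻²` times the same sum of `‖torusFourier g‖`. -/
theorem sum_weight_norm_torusFourierInv_eq (g : TorusSite 2 L → ℂ) (wt : TorusSite 2 L → ℝ) (hwt : ∀ z, wt (-z) = wt z) :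
    ∑ z : TorusSite 2 L, wt z * ‖torusFourierInv g z‖ = ((L : ℝ) ^ 2)⁻¹ * ∑ z : TorusSite 2 L, wt z * ‖torusFourier g z‖ := by
  simp_rw [norm_torusFourierInv_eq]
  rw [Finset.mul_sum, ← Equiv.sum_comp (Equiv.neg (TorusSite 2 L))]
  refine Finset.sum_congr rfl fun z _ => ?_
  simp only [Equiv.neg_apply, neg_neg, hwt]
  ring

/-! ## §2 The `ℓ¹` norm and the first moments from the sup and the differences -/

/-- **`ℓ¹` norm of the site kernel from sup + first/second differences**:
`Σ_z ‖torusFourierInv g z‖ ≤ 6·√(S₀² + L²D₁²/8 + L⁴D₂²/256)`. -/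
theorem sum_norm_torusFourierInv_le_of_differences (g : TorusSite 2 L → ℂ) {S₀ D₁ D₂ : ℝ}
    (h0 : ∀ x, ‖g x‖ ≤ S₀) (h1 : ∀ (j : Fin 2) (x : TorusSite 2 L), ‖g (x + Pi.single j 1) - g x‖ ≤ D₁)
    (h2 : ∀ x : TorusSite 2 L,
      ‖g (x + Pi.single 0 1 + Pi.single 1 1) - g (x + Pi.single 0 1) - g (x + Pi.single 1 1) + g x‖ ≤ D₂) :
    ∑ z : TorusSite 2 L, ‖torusFourierInv g z‖ ≤ 6 * Real.sqrt (S₀ ^ 2 + (L : ℝ) ^ 2 / 8 * D₁ ^ 2 + (L : ℝ) ^ 4 / 256 * D₂ ^ 2) := by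
  have h := sum_weight_norm_torusFourierInv_eq g (fun _ => (1 : ℝ)) (fun _ => rfl)
  simp only [one_mul] at h
  rw [h]
  exact sum_norm_torusFourier_le_of_differences g h0 h1 h2

/-- `tnorm z ≤ |z̃₀| + |z̃₁|` in the `valMinAbs` currency. -/
theorem tnorm_le_abs_valMinAbs_add (z : TorusSite 2 L) :
    (Torus.tnorm z : ℝ) ≤ |((z 0).valMinAbs : ℝ)| + |((z 1).valMinAbs : ℝ)| := by
  have h := tnorm_le_sum_abs_cRepZ (d := 2) z
  simp only [Fin.sum_univ_two, cRepZ_eq_valMinAbs] at h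
  exact h

omit [NeZero L] in
/-- `|(−z)̃_j| = |z̃_j|`. -/
theorem abs_valMinAbs_neg_apply (z : TorusSite 2 L) (j : Fin 2) : |(((-z) j).valMinAbs : ℝ)| = |((z j).valMinAbs : ℝ)| := by
  rw [Pi.neg_apply, ← Int.cast_abs, ← Int.cast_abs, Int.abs_eq_natAbs, Int.abs_eq_natAbs, ZMod.natAbs_valMinAbs_neg]

/-- **First centred moment of the site kernel from differences of orders one to three** (`R = 1` in the tree's lemma, both directions):
`Σ_z tnorm(z)·‖torusFourierInv g z‖ ≤ Σ_j 6·√(L²D₁²/16 + L⁴D₂²/128 + L⁶D₃²/4096)` (`= 12·√(…)`). -/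
theorem sum_tnorm_norm_torusFourierInv_le_of_differences (g : TorusSite 2 L → ℂ) {D₁ D₂ D₃ : ℝ}
    (h1 : ∀ (j : Fin 2) (x : TorusSite 2 L), ‖g (x + Pi.single j 1) - g x‖ ≤ D₁)
    (h2 : ∀ (j i : Fin 2) (x : TorusSite 2 L),
      ‖g (x + Pi.single j 1 + Pi.single i 1) - g (x + Pi.single j 1) - g (x + Pi.single i 1) + g x‖ ≤ D₂)
    (h3 : ∀ (j : Fin 2) (x : TorusSite 2 L),
      ‖(g (x + Pi.single j 1 + Pi.single 0 1 + Pi.single 1 1) - g (x + Pi.single j 1 + Pi.single 1 1) -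
          g (x + Pi.single 0 1 + Pi.single 1 1) + g (x + Pi.single 1 1)) -
        (g (x + Pi.single j 1 + Pi.single 0 1) - g (x + Pi.single j 1) - g (x + Pi.single 0 1) + g x)‖ ≤ D₃) :
    ∑ z : TorusSite 2 L, (Torus.tnorm z : ℝ) * ‖torusFourierInv g z‖ ≤
      12 * Real.sqrt ((L : ℝ) ^ 2 / 16 * D₁ ^ 2 + (L : ℝ) ^ 4 / 128 * D₂ ^ 2 + (L : ℝ) ^ 6 / 4096 * D₃ ^ 2) := by
  have hj : ∀ j : Fin 2, ∑ z : TorusSite 2 L, |((z j).valMinAbs : ℝ)| * ‖torusFourierInv g z‖ ≤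
      6 * Real.sqrt ((L : ℝ) ^ 2 / 16 * D₁ ^ 2 + (L : ℝ) ^ 4 / 128 * D₂ ^ 2 + (L : ℝ) ^ 6 / 4096 * D₃ ^ 2) := by
    intro j
    rw [sum_weight_norm_torusFourierInv_eq g (fun z => |((z j).valMinAbs : ℝ)|) (fun z => abs_valMinAbs_neg_apply z j)]
    have h := sum_abs_valMinAbs_mul_norm_torusFourier_le g j (R := 1) le_rfl (h1 j) (h2 j) (h3 j)
    simp only [Nat.cast_one, one_pow, mul_one] at h
    linarith
  calc ∑ z : TorusSite 2 L, (Torus.tnorm z : ℝ) * ‖torusFourierInv g z‖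
      ≤ ∑ z : TorusSite 2 L, (|((z 0).valMinAbs : ℝ)| + |((z 1).valMinAbs : ℝ)|) * ‖torusFourierInv g z‖ :=
        Finset.sum_le_sum fun z _ => mul_le_mul_of_nonneg_right (tnorm_le_abs_valMinAbs_add z) (norm_nonneg _)
    _ = (∑ z : TorusSite 2 L, |((z 0).valMinAbs : ℝ)| * ‖torusFourierInv g z‖) +
          ∑ z : TorusSite 2 L, |((z 1).valMinAbs : ℝ)| * ‖torusFourierInv g z‖ := by
        rw [← Finset.sum_add_distrib]; refine Finset.sum_congr rfl fun z _ => ?_; ring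
    _ ≤ _ := by have h0 := hj 0; have h1' := hj 1; linarith

/-- **The cosine-coefficient first moment of even data** (the currency `Σ_y (Σ_i |cRepZ (y i)|)·|c(y)|` of `sum_far_abs_le_of_firstMoment`):
for `F` even, `Σ_y (Σ_i |cRepZ (y i)|)·|torusCosCoeff L (Re F) y| ≤ 12·√(L²D₁²/16 + L⁴D₂²/128 + L⁶D₃²/4096)` from the differences of `F`. -/
theorem sum_absRep_abs_torusCosCoeff_le_of_differences (F : TorusSite 2 L → ℂ) (heven : ∀ k, F (-k) = F k) {D₁ D₂ D₃ : ℝ}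
    (h1 : ∀ (j : Fin 2) (x : TorusSite 2 L), ‖F (x + Pi.single j 1) - F x‖ ≤ D₁)
    (h2 : ∀ (j i : Fin 2) (x : TorusSite 2 L),
      ‖F (x + Pi.single j 1 + Pi.single i 1) - F (x + Pi.single j 1) - F (x + Pi.single i 1) + F x‖ ≤ D₂)
    (h3 : ∀ (j : Fin 2) (x : TorusSite 2 L),
      ‖(F (x + Pi.single j 1 + Pi.single 0 1 + Pi.single 1 1) - F (x + Pi.single j 1 + Pi.single 1 1) -
          F (x + Pi.single 0 1 + Pi.single 1 1) + F (x + Pi.single 1 1)) -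
        (F (x + Pi.single j 1 + Pi.single 0 1) - F (x + Pi.single j 1) - F (x + Pi.single 0 1) + F x)‖ ≤ D₃) :
    ∑ y : TorusSite 2 L, (∑ i, |(Torus.cRepZ (y i) : ℝ)|) * |torusCosCoeff L (fun k => (F k).re) y| ≤
      12 * Real.sqrt ((L : ℝ) ^ 2 / 16 * D₁ ^ 2 + (L : ℝ) ^ 4 / 128 * D₂ ^ 2 + (L : ℝ) ^ 6 / 4096 * D₃ ^ 2) := by
  have hj : ∀ j : Fin 2, ∑ z : TorusSite 2 L, |((z j).valMinAbs : ℝ)| * ‖torusFourierInv F z‖ ≤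
      6 * Real.sqrt ((L : ℝ) ^ 2 / 16 * D₁ ^ 2 + (L : ℝ) ^ 4 / 128 * D₂ ^ 2 + (L : ℝ) ^ 6 / 4096 * D₃ ^ 2) := by
    intro j
    rw [sum_weight_norm_torusFourierInv_eq F (fun z => |((z j).valMinAbs : ℝ)|) (fun z => abs_valMinAbs_neg_apply z j)]
    have h := sum_abs_valMinAbs_mul_norm_torusFourier_le F j (R := 1) le_rfl (h1 j) (h2 j) (h3 j)
    simp only [Nat.cast_one, one_pow, mul_one] at h
    linarith
  have hpt : ∀ y : TorusSite 2 L, (∑ i, |(Torus.cRepZ (y i) : ℝ)|) * |torusCosCoeff L (fun k => (F k).re) y| ≤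
      (|((y 0).valMinAbs : ℝ)| + |((y 1).valMinAbs : ℝ)|) * ‖torusFourierInv F y‖ := by
    intro y
    rw [torusCosCoeff_re_eq_re_torusFourierInv_of_even F heven y]
    simp only [Fin.sum_univ_two, cRepZ_eq_valMinAbs]
    exact mul_le_mul_of_nonneg_left (Complex.abs_re_le_norm _) (by positivity)
  calc ∑ y : TorusSite 2 L, (∑ i, |(Torus.cRepZ (y i) : ℝ)|) * |torusCosCoeff L (fun k => (F k).re) y|
      ≤ ∑ y : TorusSite 2 L, (|((y 0).valMinAbs : ℝ)| + |((y 1).valMinAbs : ℝ)|) * ‖torusFourierInv F y‖ := Finset.sum_le_sum fun y _ => hpt y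
    _ = (∑ z : TorusSite 2 L, |((z 0).valMinAbs : ℝ)| * ‖torusFourierInv F z‖) +
          ∑ z : TorusSite 2 L, |((z 1).valMinAbs : ℝ)| * ‖torusFourierInv F z‖ := by
        rw [← Finset.sum_add_distrib]; refine Finset.sum_congr rfl fun z _ => ?_; ring
    _ ≤ _ := by have h0 := hj 0; have h1' := hj 1; linarith

end Summit.HubbardSuperconductivity.HubbardSuperconductivity.Theorems.TwoVolumeDefect

end
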